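import Summits.AtomisticToContinuum.Crystallization.Theorems.SquareWellLayerCakeStackingFaultSparsityLocalFramesLimitB

/-!
# Crux `StackingFaultSparsity` (stmt-AtomisticToContinuum-14296), line `Sketch` — stub `stub_localFrameLimit`, C

The shell of a limit point, for the compactness step S0 (`stub_localFrameLimit`), in the setting
of part B (one `ε`-late normalised window `w : Fin N → ℝ³` about `J`, `w J` close to `p ∈ X`,
robust tolerance `ε`). We prove:

* `lf_card_image` — an injective `Fin K`-family has an image finset of `K` elements;
* `lf_family` — the `6` same-label, `3` label-up and `3` label-down counted partners of a
  particle within `1` of `J`, as injective families with sharp bonds (one shape, label offset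
  `s ∈ {0, 1, -1}`);
* `lf_matched_family` — such a family about a particle `jq` that approximates `q ∈ X` is matched
  into `X`: `K` distinct points of `X \ {q}` at height EXACTLY `cl (L jq + s)` above `p` and at
  distance EXACTLY the limit length from `q`, each `δ`-close to its partner;
* `lf_shell` — at `p` itself: `6 + 3 + 3` matched points at heights `0`, `cl 1`, `cl (-1)` and
  distances `al`, `bl`, `bl`, and EXACTNESS of the closed unit shell of `p` in `X` — every
  `q ∈ X \ {p}` with `dist q p ≤ 1` is one of them (a thirteenth point would violate the laminar
  kissing caps `lf_cap_level` / `lf_cap_adjacent` in the limit).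
-/

noncomputable section

namespace Summit.AtomisticToContinuum.Crystallization.Theorems.SquareWellLayerCake.StackingFaultSparsity.LocalFrames.Limit

open Filter Metric Topology

/-- The image finset of an injective family `Fin K → ℝ³` has `K` elements. -/
theorem lf_card_image :
    ∀ {K : ℕ} {t : Fin K → EuclideanSpace ℝ (Fin 3)}, Function.Injective t → (Finset.univ.image t).card = K := by
  intro K t ht
  rw [Finset.card_image_of_injective _ ht, Finset.card_univ, Fintype.card_fin]

/-! ## Counted partners -/

/-- The counted partners of a particle `jq` within `1` of the centre `J` of a normalised window:
`6` of the same label with bonds `δ`-close to `a`, `3` one label up and `3` one label down with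
bonds `δ`-close to `b`, as injective families of particles `≠ jq` within distance `1`. -/
theorem lf_family {N : ℕ} {w : Fin N → EuclideanSpace ℝ (Fin 3)} {J : Fin N} {a b δ : ℝ}
    {n : EuclideanSpace ℝ (Fin 3)} {C : ℤ → ℝ} {L : Fin N → ℤ}
    (hW : 19 / 20 ≤ a ∧ a ≤ 1 ∧ 19 / 20 ≤ b ∧ b ≤ 1 ∧ ‖n‖ = 1 ∧ C 0 = 0 ∧
      (∀ t : ℤ, C t + 19 / 25 ≤ C (t + 1)) ∧ L J = 0 ∧ 0 ≤ δ ∧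
      (∀ j : Fin N, dist (w j) (w J) ≤ 2 → |inner ℝ (w j - w J) n - C (L j)| ≤ δ) ∧
      (∀ j j' : Fin N, dist (w j) (w J) ≤ 2 → dist (w j') (w J) ≤ 2 → j ≠ j' →
        19 / 20 ≤ dist (w j) (w j')) ∧
      ∀ j : Fin N, dist (w j) (w J) ≤ 1 →
        Nat.card {k : Fin N // k ≠ j ∧ L k = L j ∧ dist (w j) (w k) ≤ 1} = 6 ∧
        Nat.card {k : Fin N // L k = L j + 1 ∧ dist (w j) (w k) ≤ 1} = 3 ∧
        Nat.card {k : Fin N // L k = L j - 1 ∧ dist (w j) (w k) ≤ 1} = 3 ∧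
        ∀ k : Fin N, k ≠ j → dist (w j) (w k) ≤ 1 →
          (L k = L j → |dist (w j) (w k) - a| ≤ δ) ∧ (L k ≠ L j → |dist (w j) (w k) - b| ≤ δ))
    {jq : Fin N} (hjq : dist (w jq) (w J) ≤ 1) :
    (∃ g : Fin 6 → Fin N, Function.Injective g ∧ ∀ i, g i ≠ jq ∧ dist (w jq) (w (g i)) ≤ 1 ∧
        L (g i) = L jq + 0 ∧ |dist (w jq) (w (g i)) - a| ≤ δ) ∧
    (∃ g : Fin 3 → Fin N, Function.Injective g ∧ ∀ i, g i ≠ jq ∧ dist (w jq) (w (g i)) ≤ 1 ∧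
        L (g i) = L jq + 1 ∧ |dist (w jq) (w (g i)) - b| ≤ δ) ∧
    (∃ g : Fin 3 → Fin N, Function.Injective g ∧ ∀ i, g i ≠ jq ∧ dist (w jq) (w (g i)) ≤ 1 ∧
        L (g i) = L jq + (-1) ∧ |dist (w jq) (w (g i)) - b| ≤ δ) := by
  obtain ⟨-, -, -, -, -, -, -, -, -, -, -, hcnt⟩ := hW
  obtain ⟨h6, h3u, h3d, hsh⟩ := hcnt jq hjq
  refine ⟨?_, ?_, ?_⟩
  · obtain ⟨g, hg, hP⟩ := PeriodicWindowsSketch.gl_exists_injective_of_card _ h6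
    refine ⟨g, hg, fun i => ?_⟩
    obtain ⟨hne, hl, hd⟩ := hP i
    exact ⟨hne, hd, by rw [hl, add_zero], (hsh (g i) hne hd).1 hl⟩
  · obtain ⟨g, hg, hP⟩ := PeriodicWindowsSketch.gl_exists_injective_of_card _ h3u
    refine ⟨g, hg, fun i => ?_⟩
    obtain ⟨hl, hd⟩ := hP i
    have hlne : L (g i) ≠ L jq := by rw [hl]; simp
    have hne : g i ≠ jq := fun h => hlne (by rw [h])
    exact ⟨hne, hd, hl, (hsh (g i) hne hd).2 hlne⟩
  · obtain ⟨g, hg, hP⟩ := PeriodicWindowsSketch.gl_exists_injective_of_card _ h3d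
    refine ⟨g, hg, fun i => ?_⟩
    obtain ⟨hl, hd⟩ := hP i
    have hlne : L (g i) ≠ L jq := by rw [hl]; simp
    have hne : g i ≠ jq := fun h => hlne (by rw [h])
    exact ⟨hne, hd, by rw [hl]; ring, (hsh (g i) hne hd).2 hlne⟩

/-! ## Matching a family into the limit -/

/-- **Matched family.** In an `ε`-late window about `J` (`w J` close to `p`), let `jq` be a
particle within `1` of `J` that is `δ`-close to `q ∈ X`, and `g` an injective family of `K`
partners of `jq` (`≠ jq`, within `1`, labels `L jq + s`, bonds `δ`-close to `ℓ`
with `|ℓ - ℓl| ≤ ε`, `ℓl ∈ {al, bl}`). Then the partners are `δ`-close to `K` pairwise distinct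
points of `X \ {q}` whose heights above `p` along `nl` are EXACTLY `cl (L jq + s)` and whose
distances from `q` are EXACTLY `ℓl`. -/
theorem lf_matched_family {X : Set (EuclideanSpace ℝ (Fin 3))} {p : EuclideanSpace ℝ (Fin 3)}
    {N : ℕ} {w : Fin N → EuclideanSpace ℝ (Fin 3)} {J : Fin N} {a b δ ε al bl : ℝ}
    {n nl : EuclideanSpace ℝ (Fin 3)} {C cl : ℤ → ℝ} {L : Fin N → ℤ}
    (hW : 19 / 20 ≤ a ∧ a ≤ 1 ∧ 19 / 20 ≤ b ∧ b ≤ 1 ∧ ‖n‖ = 1 ∧ C 0 = 0 ∧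
      (∀ t : ℤ, C t + 19 / 25 ≤ C (t + 1)) ∧ L J = 0 ∧ 0 ≤ δ ∧
      (∀ j : Fin N, dist (w j) (w J) ≤ 2 → |inner ℝ (w j - w J) n - C (L j)| ≤ δ) ∧
      (∀ j j' : Fin N, dist (w j) (w J) ≤ 2 → dist (w j') (w J) ≤ 2 → j ≠ j' →
        19 / 20 ≤ dist (w j) (w j')) ∧
      ∀ j : Fin N, dist (w j) (w J) ≤ 1 →
        Nat.card {k : Fin N // k ≠ j ∧ L k = L j ∧ dist (w j) (w k) ≤ 1} = 6 ∧
        Nat.card {k : Fin N // L k = L j + 1 ∧ dist (w j) (w k) ≤ 1} = 3 ∧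
        Nat.card {k : Fin N // L k = L j - 1 ∧ dist (w j) (w k) ≤ 1} = 3 ∧
        ∀ k : Fin N, k ≠ j → dist (w j) (w k) ≤ 1 →
          (L k = L j → |dist (w j) (w k) - a| ≤ δ) ∧ (L k ≠ L j → |dist (w j) (w k) - b| ≤ δ))
    (hRob : 0 < ε ∧ ε ≤ 1 / 100 ∧
      (∀ t ∈ X, ∀ t' ∈ X, dist t p ≤ 3 → dist t' p ≤ 3 →
        (|dist t t' - al| ≤ 10 * ε → dist t t' = al) ∧
        (|dist t t' - bl| ≤ 10 * ε → dist t t' = bl)) ∧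
      (∀ t ∈ X, dist t p ≤ 3 → ∀ s : ℤ, -3 ≤ s → s ≤ 3 →
        |inner ℝ (t - p) nl - cl s| ≤ 10 * ε → inner ℝ (t - p) nl = cl s))
    (hLate : δ ≤ ε ∧ ‖n - nl‖ ≤ ε ∧ |a - al| ≤ ε ∧ |b - bl| ≤ ε ∧
      (∀ s : ℤ, -3 ≤ s → s ≤ 3 → |C s - cl s| ≤ ε) ∧ dist (w J) p ≤ δ ∧
      ∀ j, dist (w j) p ≤ 4 → ∃ x ∈ X, dist (w j) x ≤ δ)
    {q : EuclideanSpace ℝ (Fin 3)} (hq : q ∈ X) {jq : Fin N} (hjq : dist (w jq) q ≤ δ)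
    (hjqJ : dist (w jq) (w J) ≤ 1) {K : ℕ} {s : ℤ} {ℓ ℓl : ℝ}
    (hℓ : |ℓ - ℓl| ≤ ε) (hℓl : ℓl = al ∨ ℓl = bl) {g : Fin K → Fin N}
    (hg : Function.Injective g)
    (hgP : ∀ i, g i ≠ jq ∧ dist (w jq) (w (g i)) ≤ 1 ∧ L (g i) = L jq + s ∧
      |dist (w jq) (w (g i)) - ℓ| ≤ δ) :
    ∃ t : Fin K → EuclideanSpace ℝ (Fin 3), Function.Injective t ∧
      ∀ i, t i ∈ X ∧ t i ≠ q ∧ dist (w (g i)) (t i) ≤ δ ∧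
        inner ℝ (t i - p) nl = cl (L jq + s) ∧ dist q (t i) = ℓl := by
  obtain ⟨-, hε1, hR1, hR2⟩ := hRob
  obtain ⟨hδε, hnn, -, -, hCc, hJp, hM2⟩ := hLate
  have hW' := hW
  obtain ⟨-, -, -, -, -, -, -, -, hδ0, -, hsepW, -⟩ := hW'
  have hqp : dist q p ≤ 1 + 2 * ε :=
    calc dist q p ≤ dist q (w jq) + dist (w jq) (w J) + dist (w J) p := dist_triangle4 _ _ _ _
      _ ≤ δ + 1 + δ := by rw [dist_comm q]; gcongr
      _ ≤ 1 + 2 * ε := by linarith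
  have hgJ : ∀ i, dist (w (g i)) (w J) ≤ 2 := fun i =>
    calc dist (w (g i)) (w J) ≤ dist (w (g i)) (w jq) + dist (w jq) (w J) := dist_triangle _ _ _
      _ ≤ 1 + 1 := by rw [dist_comm]; exact add_le_add (hgP i).2.1 hjqJ
      _ = 2 := by norm_num
  have hjqJ2 : dist (w jq) (w J) ≤ 2 := hjqJ.trans (by norm_num)
  have hmatch : ∀ i, ∃ x ∈ X, dist (w (g i)) x ≤ δ := fun i => hM2 (g i) <|
    calc dist (w (g i)) p ≤ dist (w (g i)) (w jq) + dist (w jq) q + dist q p :=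
          dist_triangle4 _ _ _ _
      _ ≤ 1 + δ + (1 + 2 * ε) := by
          rw [dist_comm (w (g i))]
          exact add_le_add (add_le_add (hgP i).2.1 hjq) hqp
      _ ≤ 4 := by linarith
  choose t htX ht using hmatch
  refine ⟨t, ?_, fun i => ⟨htX i, ?_, ht i, ?_, ?_⟩⟩
  · -- the matched points are pairwise distinct
    intro i i' hii'
    by_contra hne
    have hsep := hsepW (g i) (g i') (hgJ i) (hgJ i') (hg.ne hne)
    have htr := lf_dist_transfer (ht i) (ht i')
    rw [hii', dist_self] at htr
    have := abs_le.1 htr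
    linarith
  · -- the matched points are not `q`
    intro heq
    have hsep := hsepW (g i) jq (hgJ i) hjqJ2 (hgP i).1
    have htr := lf_dist_transfer (ht i) hjq
    rw [heq, dist_self] at htr
    have := abs_le.1 htr
    linarith
  · -- heights
    rw [(lf_label hW hR2 hδε hε1 hnn hCc hJp (htX i) (ht i) (hgJ i)).2.2, (hgP i).2.2.1]
  · -- distances
    have htr := abs_le.1 (lf_dist_transfer hjq (ht i))
    have hd := abs_le.1 (hgP i).2.2.2
    have hl := abs_le.1 hℓ
    have htp : dist (t i) p ≤ 3 :=
      calc dist (t i) p ≤ dist (t i) (w (g i)) + dist (w (g i)) (w J) + dist (w J) p :=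
            dist_triangle4 _ _ _ _
        _ ≤ δ + 2 + δ := by
            rw [dist_comm (t i)]
            exact add_le_add (add_le_add (ht i) (hgJ i)) hJp
        _ ≤ 3 := by linarith
    have hqp3 : dist q p ≤ 3 := by linarith
    have key : |dist q (t i) - ℓl| ≤ 10 * ε := by
      rw [abs_le]
      constructor <;> linarith
    rcases hℓl with rfl | rfl
    · exact (hR1 q hq (t i) (htX i) hqp3 htp).1 key
    · exact (hR1 q hq (t i) (htX i) hqp3 htp).2 key

/-! ## The shell of `p` and its exactness -/

/-- **Shell of `p`.** In an `ε`-late window: `6` pairwise distinct points of `X \ {p}` at height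
`0` and distance `al` from `p`, `3` at height `cl 1` and `3` at height `cl (-1)` at distance `bl`,
each `δ`-close to a counted partner of `J`; and every `q ∈ X \ {p}` with `dist q p ≤ 1` is one
of these twelve points (laminar kissing caps in the limit). -/
theorem lf_shell {X : Set (EuclideanSpace ℝ (Fin 3))} {p : EuclideanSpace ℝ (Fin 3)}
    {N : ℕ} {w : Fin N → EuclideanSpace ℝ (Fin 3)} {J : Fin N} {a b δ ε al bl : ℝ}
    {n nl : EuclideanSpace ℝ (Fin 3)} {C cl : ℤ → ℝ} {L : Fin N → ℤ}
    (hXsep : ∀ q ∈ X, ∀ r ∈ X, q ≠ r → (19 : ℝ) / 20 ≤ dist q r) (hp : p ∈ X)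
    (hLim : 19 / 20 ≤ al ∧ al ≤ 1 ∧ 19 / 20 ≤ bl ∧ bl ≤ 1 ∧ ‖nl‖ = 1 ∧ cl 0 = 0 ∧
      ∀ t : ℤ, cl t + 19 / 25 ≤ cl (t + 1))
    (hW : 19 / 20 ≤ a ∧ a ≤ 1 ∧ 19 / 20 ≤ b ∧ b ≤ 1 ∧ ‖n‖ = 1 ∧ C 0 = 0 ∧
      (∀ t : ℤ, C t + 19 / 25 ≤ C (t + 1)) ∧ L J = 0 ∧ 0 ≤ δ ∧
      (∀ j : Fin N, dist (w j) (w J) ≤ 2 → |inner ℝ (w j - w J) n - C (L j)| ≤ δ) ∧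
      (∀ j j' : Fin N, dist (w j) (w J) ≤ 2 → dist (w j') (w J) ≤ 2 → j ≠ j' →
        19 / 20 ≤ dist (w j) (w j')) ∧
      ∀ j : Fin N, dist (w j) (w J) ≤ 1 →
        Nat.card {k : Fin N // k ≠ j ∧ L k = L j ∧ dist (w j) (w k) ≤ 1} = 6 ∧
        Nat.card {k : Fin N // L k = L j + 1 ∧ dist (w j) (w k) ≤ 1} = 3 ∧
        Nat.card {k : Fin N // L k = L j - 1 ∧ dist (w j) (w k) ≤ 1} = 3 ∧
        ∀ k : Fin N, k ≠ j → dist (w j) (w k) ≤ 1 →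
          (L k = L j → |dist (w j) (w k) - a| ≤ δ) ∧ (L k ≠ L j → |dist (w j) (w k) - b| ≤ δ))
    (hRob : 0 < ε ∧ ε ≤ 1 / 100 ∧
      (∀ t ∈ X, ∀ t' ∈ X, dist t p ≤ 3 → dist t' p ≤ 3 →
        (|dist t t' - al| ≤ 10 * ε → dist t t' = al) ∧
        (|dist t t' - bl| ≤ 10 * ε → dist t t' = bl)) ∧
      (∀ t ∈ X, dist t p ≤ 3 → ∀ s : ℤ, -3 ≤ s → s ≤ 3 →
        |inner ℝ (t - p) nl - cl s| ≤ 10 * ε → inner ℝ (t - p) nl = cl s))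
    (hLate : δ ≤ ε ∧ ‖n - nl‖ ≤ ε ∧ |a - al| ≤ ε ∧ |b - bl| ≤ ε ∧
      (∀ s : ℤ, -3 ≤ s → s ≤ 3 → |C s - cl s| ≤ ε) ∧ dist (w J) p ≤ δ ∧
      ∀ j, dist (w j) p ≤ 4 → ∃ x ∈ X, dist (w j) x ≤ δ)
    (hflatX : ∀ x ∈ X, dist x p < 2 → ∃ t : ℤ, inner ℝ (x - p) nl = cl t) :
    ∃ (tH : Fin 6 → EuclideanSpace ℝ (Fin 3)) (tU tD : Fin 3 → EuclideanSpace ℝ (Fin 3)),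
      (∀ i, tH i ∈ X ∧ tH i ≠ p ∧ inner ℝ (tH i - p) nl = 0 ∧ dist p (tH i) = al ∧
        ∃ g : Fin N, dist (w g) (tH i) ≤ δ ∧ dist (w g) (w J) ≤ 1) ∧
      (∀ i, tU i ∈ X ∧ inner ℝ (tU i - p) nl = cl 1 ∧ dist p (tU i) = bl ∧
        ∃ g : Fin N, dist (w g) (tU i) ≤ δ ∧ dist (w g) (w J) ≤ 1) ∧
      (∀ i, tD i ∈ X ∧ inner ℝ (tD i - p) nl = cl (-1) ∧ dist p (tD i) = bl ∧
        ∃ g : Fin N, dist (w g) (tD i) ≤ δ ∧ dist (w g) (w J) ≤ 1) ∧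
      Function.Injective tH ∧ Function.Injective tU ∧ Function.Injective tD ∧
      ∀ q ∈ X, q ≠ p → dist q p ≤ 1 → (∃ i, tH i = q) ∨ (∃ i, tU i = q) ∨ (∃ i, tD i = q) := by
  obtain ⟨-, hal2, -, hbl2, hnl, hcl0, hclg⟩ := hLim
  have hLate' := hLate
  obtain ⟨-, -, haa, hbb, -, hJp, -⟩ := hLate'
  have hW' := hW
  obtain ⟨-, -, -, -, -, -, -, hLJ, -, -, -, -⟩ := hW'
  have hJJ : dist (w J) (w J) ≤ 1 := by rw [dist_self]; norm_num
  obtain ⟨⟨gH, hgH, hPH⟩, ⟨gU, hgU, hPU⟩, ⟨gD, hgD, hPD⟩⟩ := lf_family hW hJJ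
  obtain ⟨tH, htH, hH⟩ := lf_matched_family hW hRob hLate hp hJp hJJ haa (Or.inl rfl) hgH hPH
  obtain ⟨tU, htU, hU⟩ := lf_matched_family hW hRob hLate hp hJp hJJ hbb (Or.inr rfl) hgU hPU
  obtain ⟨tD, htD, hD⟩ := lf_matched_family hW hRob hLate hp hJp hJJ hbb (Or.inr rfl) hgD hPD
  rw [hLJ] at hH hU hD
  have hH' : ∀ i, tH i ∈ X ∧ tH i ≠ p ∧ inner ℝ (tH i - p) nl = 0 ∧ dist p (tH i) = al ∧
      ∃ g : Fin N, dist (w g) (tH i) ≤ δ ∧ dist (w g) (w J) ≤ 1 := fun i =>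
    ⟨(hH i).1, (hH i).2.1, by rw [(hH i).2.2.2.1, add_zero, hcl0], (hH i).2.2.2.2, gH i,
      (hH i).2.2.1, by rw [dist_comm]; exact (hPH i).2.1⟩
  have hU' : ∀ i, tU i ∈ X ∧ inner ℝ (tU i - p) nl = cl 1 ∧ dist p (tU i) = bl ∧
      ∃ g : Fin N, dist (w g) (tU i) ≤ δ ∧ dist (w g) (w J) ≤ 1 := fun i =>
    ⟨(hU i).1, by rw [(hU i).2.2.2.1, zero_add], (hU i).2.2.2.2, gU i, (hU i).2.2.1,
      by rw [dist_comm]; exact (hPU i).2.1⟩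
  have hD' : ∀ i, tD i ∈ X ∧ inner ℝ (tD i - p) nl = cl (-1) ∧ dist p (tD i) = bl ∧
      ∃ g : Fin N, dist (w g) (tD i) ≤ δ ∧ dist (w g) (w J) ≤ 1 := fun i =>
    ⟨(hD i).1, by rw [(hD i).2.2.2.1, zero_add], (hD i).2.2.2.2, gD i, (hD i).2.2.1,
      by rw [dist_comm]; exact (hPD i).2.1⟩
  refine ⟨tH, tU, tD, hH', hU', hD', htH, htU, htD, fun q hq hqp hqp1 => ?_⟩
  obtain ⟨t, ht⟩ := hflatX q hq (by linarith)
  have hqt : |cl t| ≤ 37 / 25 := by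
    rw [← ht]
    calc |inner ℝ (q - p) nl| ≤ ‖q - p‖ * ‖nl‖ := abs_real_inner_le_norm _ _
      _ ≤ 37 / 25 := by rw [hnl, mul_one, ← dist_eq_norm]; linarith
  obtain ⟨ht1, ht2⟩ := lf_label_le_one hcl0 hclg hqt
  by_contra hcon
  push Not at hcon
  obtain ⟨hnH, hnU, hnD⟩ := hcon
  obtain ⟨hc1, hcm1⟩ := lf_abs_level_one hcl0 hclg
  interval_cases t
  · exact lf_cap_adjacent hXsep hnl hcm1 q tD htD hnD ⟨hq, hqp1, ht⟩
      fun i => ⟨(hD' i).1, by rw [dist_comm, (hD' i).2.2.1]; exact hbl2, (hD' i).2.1⟩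
  · exact lf_cap_level hXsep hp hnl q tH htH hnH ⟨hq, hqp, hqp1, by rw [ht, hcl0]⟩
      fun i => ⟨(hH' i).1, (hH' i).2.1, by rw [dist_comm, (hH' i).2.2.2.1]; exact hal2,
        (hH' i).2.2.1⟩
  · exact lf_cap_adjacent hXsep hnl hc1 q tU htU hnU ⟨hq, hqp1, ht⟩
      fun i => ⟨(hU' i).1, by rw [dist_comm, (hU' i).2.2.1]; exact hbl2, (hU' i).2.1⟩

end Summit.AtomisticToContinuum.Crystallization.Theorems.SquareWellLayerCake.StackingFaultSparsity.LocalFrames.Limit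

end
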